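import Summits.BirchSwinnertonDyer.BirchSwinnertonDyer.Theorems.ManinLocalTwoThreeCubeRootBoundedSubring
import Mathlib.Algebra.QuadraticAlgebra.Basic
import HarnessLib

/-!
# (BI)_K, piece P1: power series over a quadratic algebra `K[ω]/(ω² = r)` in components, and cube roots up to roots of unity
(route `ManinLocalTwoThree`, crux C3 `ManinPrimeToThreeAtNine` stmt-BirchSwinnertonDyer-22968 — residual RES₃♭, -an g39's `K`-line, stub (BI)_K
`UDCKummerLineK.KummerCubeRootThreeBoundedK`; cell bsd-f2-manin, prover seat p2 gen 18; `--supports stmt-BirchSwinnertonDyer-22968`)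

Bookkeeping for the non-split (BI)_K (p2's revised census, STATUS 2026-08-29T18:4xZ): the tripling identity is run over the field
`k = QuadraticAlgebra ℚ₃ r₃ 0` (Mathlib's field instance under `Fact (∀ x, x² ≠ r₃)`) and read in COMPONENTS over `ℚ₃`, where p3's
`CubeSystemDescent.dvd_of_cube_system` (p736149) does the `3`-adic descent in the UFD `ℤ₃⟦q⟧`.

* the «combination» `map p + C ω · map q` (`p, q ∈ K⟦X⟧`; written out, no definition): every `F ∈ (K[ω])⟦X⟧` is the combination of its real-
  and `ω`-part series; the combination is injective in `(p, q)`; product and cube formulae (`ω² = r`): `(p + ωq)(p' + ωq') = (pp' + r qq') + ω(pq' + p'q)`,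
  `(p + ωq)³ = (p³ + 3r p q²) + ω(3p²q + r q³)`, and the NORM `(p + ωq)(p − ωq) = p² − r q²`.
* `eq_C_mul_of_pow_three_eq'` — in `k⟦X⟧` over any field `k`: `x³ = y³ ⟹ x = C ζ · y` with `ζ³ = 1` (via `divXPowOrder`, extending p2's
  `eq_C_mul_of_pow_three_eq`, p736549, which needs `y(0) ≠ 0`).

HONEST FRAMING.  Algebra only; (BI)_K, KLINE, RES₃♭, C3, Manin's conjecture and BSD are NOT proved.  No sorry, no new axioms. [folklore]
-/

set_option autoImplicit false
-- lint-debt: the directory name repeats the summit name (sibling precedent `ManinLocalTwoThreeCubeRootComponents.lean`)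
set_option linter.dupNamespace false

noncomputable section

open scoped Classical QuadraticAlgebra
open PowerSeries

namespace Summit.BirchSwinnertonDyer.BirchSwinnertonDyer.Theorems.ManinLocalTwoThree.KLineBI

/-! ### §1 Components of power series over `K[ω]` -/

section Components

variable {K : Type*} [Field K] {r : K}

/-- Coefficients of `comb p q`: `⟨pₙ, qₙ⟩`. [folklore] -/
theorem coeff_comb (p q : K⟦X⟧) (n : ℕ) :
    coeff n (PowerSeries.map (algebraMap K (QuadraticAlgebra K r 0)) p + C (ω : QuadraticAlgebra K r 0) * PowerSeries.map (algebraMap K (QuadraticAlgebra K r 0)) q) = ⟨coeff n p, coeff n q⟩ := by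
  rw [map_add, coeff_map, coeff_C_mul, coeff_map, QuadraticAlgebra.algebraMap_eq, QuadraticAlgebra.algebraMap_eq,
    QuadraticAlgebra.omega_mul_mk]
  apply QuadraticAlgebra.ext <;> simp

/-- Every series over `K[ω]` is `comb (reS F) (imS F)`. [folklore] -/
theorem comb_reS_imS (F : (QuadraticAlgebra K r 0)⟦X⟧) :
    (PowerSeries.map (algebraMap K (QuadraticAlgebra K r 0)) (PowerSeries.mk fun n ↦ (coeff n F).re) + C (ω : QuadraticAlgebra K r 0) * PowerSeries.map (algebraMap K (QuadraticAlgebra K r 0)) (PowerSeries.mk fun n ↦ (coeff n F).im)) = F := by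
  ext n <;> simp [coeff_comb, coeff_mk]

/-- `comb` is injective in the pair `(p, q)`. [folklore] -/
theorem comb_injective {p q p' q' : K⟦X⟧}
    (h : (PowerSeries.map (algebraMap K (QuadraticAlgebra K r 0)) p + C (ω : QuadraticAlgebra K r 0) * PowerSeries.map (algebraMap K (QuadraticAlgebra K r 0)) q) =
      (PowerSeries.map (algebraMap K (QuadraticAlgebra K r 0)) p' + C (ω : QuadraticAlgebra K r 0) * PowerSeries.map (algebraMap K (QuadraticAlgebra K r 0)) q')) : p = p' ∧ q = q' := by
  constructor
  · ext n
    have := congrArg (fun F => (coeff n F).re) h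
    simpa [coeff_comb] using this
  · ext n
    have := congrArg (fun F => (coeff n F).im) h
    simpa [coeff_comb] using this

/-- `comb` is additive. [folklore] -/
theorem comb_add (p q p' q' : K⟦X⟧) :
    (PowerSeries.map (algebraMap K (QuadraticAlgebra K r 0)) p + C (ω : QuadraticAlgebra K r 0) * PowerSeries.map (algebraMap K (QuadraticAlgebra K r 0)) q) +
      (PowerSeries.map (algebraMap K (QuadraticAlgebra K r 0)) p' + C (ω : QuadraticAlgebra K r 0) * PowerSeries.map (algebraMap K (QuadraticAlgebra K r 0)) q') =
      (PowerSeries.map (algebraMap K (QuadraticAlgebra K r 0)) (p + p') + C (ω : QuadraticAlgebra K r 0) * PowerSeries.map (algebraMap K (QuadraticAlgebra K r 0)) (q + q')) := by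
  simp only [map_add]; ring

/-- `ω² = r` in `K[ω]⟦X⟧`. [folklore] -/
theorem C_omega_sq : (C (ω : QuadraticAlgebra K r 0) : (QuadraticAlgebra K r 0)⟦X⟧) ^ 2 =
    PowerSeries.map (algebraMap K (QuadraticAlgebra K r 0)) (C r) := by
  rw [← map_pow, PowerSeries.map_C, sq, QuadraticAlgebra.omega_mul_omega_eq_mk, QuadraticAlgebra.algebraMap_eq]

/-- **Product formula**: `(p + ωq)(p' + ωq') = (pp' + r qq') + ω(pq' + p'q)`. [folklore] -/
theorem comb_mul_comb (p q p' q' : K⟦X⟧) :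
    (PowerSeries.map (algebraMap K (QuadraticAlgebra K r 0)) p + C (ω : QuadraticAlgebra K r 0) * PowerSeries.map (algebraMap K (QuadraticAlgebra K r 0)) q) *
      (PowerSeries.map (algebraMap K (QuadraticAlgebra K r 0)) p' + C (ω : QuadraticAlgebra K r 0) * PowerSeries.map (algebraMap K (QuadraticAlgebra K r 0)) q') =
      (PowerSeries.map (algebraMap K (QuadraticAlgebra K r 0)) (p * p' + C r * q * q') + C (ω : QuadraticAlgebra K r 0) * PowerSeries.map (algebraMap K (QuadraticAlgebra K r 0)) (p * q' + p' * q)) := by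
  have hω := C_omega_sq (K := K) (r := r)
  simp only [map_add, map_mul]
  rw [← hω]
  ring

/-- **Cube formula**: `(p + ωq)³ = (p³ + 3r p q²) + ω(3p²q + r q³)`. [folklore] -/
theorem comb_pow_three (p q : K⟦X⟧) :
    (PowerSeries.map (algebraMap K (QuadraticAlgebra K r 0)) p + C (ω : QuadraticAlgebra K r 0) * PowerSeries.map (algebraMap K (QuadraticAlgebra K r 0)) q) ^ 3 =
      (PowerSeries.map (algebraMap K (QuadraticAlgebra K r 0)) (p ^ 3 + 3 * C r * p * q ^ 2) + C (ω : QuadraticAlgebra K r 0) * PowerSeries.map (algebraMap K (QuadraticAlgebra K r 0)) (3 * p ^ 2 * q + C r * q ^ 3)) := by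
  have hω := C_omega_sq (K := K) (r := r)
  simp only [map_add, map_mul, map_pow, map_ofNat]
  have hω3 : (C (ω : QuadraticAlgebra K r 0) : (QuadraticAlgebra K r 0)⟦X⟧) ^ 3 =
      C (ω : QuadraticAlgebra K r 0) * PowerSeries.map (algebraMap K (QuadraticAlgebra K r 0)) (C r) := by
    rw [pow_succ, hω, mul_comm]
  rw [show ∀ a b : (QuadraticAlgebra K r 0)⟦X⟧, (a + b) ^ 3 = a ^ 3 + 3 * a ^ 2 * b + 3 * a * b ^ 2 + b ^ 3 from fun a b => by ring,
    mul_pow, mul_pow, hω3, hω]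
  ring

/-- **Norm formula**: `(p + ωq)(p − ωq) = p² − r q²` (no `ω`-part). [folklore] -/
theorem comb_mul_comb_neg (p q : K⟦X⟧) :
    (PowerSeries.map (algebraMap K (QuadraticAlgebra K r 0)) p + C (ω : QuadraticAlgebra K r 0) * PowerSeries.map (algebraMap K (QuadraticAlgebra K r 0)) q) *
      (PowerSeries.map (algebraMap K (QuadraticAlgebra K r 0)) p + C (ω : QuadraticAlgebra K r 0) * PowerSeries.map (algebraMap K (QuadraticAlgebra K r 0)) (-q)) =
      (PowerSeries.map (algebraMap K (QuadraticAlgebra K r 0)) (p ^ 2 - C r * q ^ 2) + C (ω : QuadraticAlgebra K r 0) * PowerSeries.map (algebraMap K (QuadraticAlgebra K r 0)) 0) := by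
  rw [comb_mul_comb]
  have e1 : p * p + C r * q * -q = p ^ 2 - C r * q ^ 2 := by ring
  have e2 : p * -q + p * q = 0 := by ring
  rw [e1, e2]

/-- `comb p 0 = map p`. [folklore] -/
theorem comb_zero_right (p : K⟦X⟧) :
    (PowerSeries.map (algebraMap K (QuadraticAlgebra K r 0)) p + C (ω : QuadraticAlgebra K r 0) * PowerSeries.map (algebraMap K (QuadraticAlgebra K r 0)) 0) = PowerSeries.map (algebraMap K (QuadraticAlgebra K r 0)) p := by
  simp

/-- `C`-constants: `comb (C x) (C y) = C ⟨x, y⟩`. [folklore] -/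
theorem comb_C (x y : K) :
    (PowerSeries.map (algebraMap K (QuadraticAlgebra K r 0)) (C x) + C (ω : QuadraticAlgebra K r 0) * PowerSeries.map (algebraMap K (QuadraticAlgebra K r 0)) (C y)) = C (⟨x, y⟩ : QuadraticAlgebra K r 0) := by
  refine PowerSeries.ext fun n => ?_
  rw [coeff_comb, coeff_C, coeff_C, coeff_C]
  split_ifs <;> rfl

end Components

/-! ### §2 Cube roots agree up to a root of unity (general) -/

section CubeRoots

variable {k : Type*} [Field k]

/-- **`x³ = y³ ⟹ x = C ζ · y` with `ζ³ = 1`** in `k⟦X⟧`, for ANY `y` (reduce to nonvanishing constant term by `divXPowOrder`). [folklore] -/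
theorem eq_C_mul_of_pow_three_eq' {x y : k⟦X⟧} (hxy : x ^ 3 = y ^ 3) : ∃ ζ : k, ζ ^ 3 = 1 ∧ x = C ζ * y := by
  by_cases hy : y = 0
  · refine ⟨1, one_pow 3, ?_⟩
    have hx : x = 0 := pow_eq_zero_iff three_ne_zero |>.mp (by rw [hxy, hy, zero_pow three_ne_zero])
    rw [hx, hy, mul_zero]
  have hx : x ≠ 0 := by
    intro h0; apply hy
    exact pow_eq_zero_iff three_ne_zero |>.mp (by rw [← hxy, h0, zero_pow three_ne_zero])
  -- orders agree
  have hord : x.order = y.order := by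
    have h := congrArg PowerSeries.order hxy
    rw [order_pow, order_pow] at h
    have hxo : x.order ≠ ⊤ := fun h0 => hx (order_eq_top.mp h0)
    have hyo : y.order ≠ ⊤ := fun h0 => hy (order_eq_top.mp h0)
    obtain ⟨m, hm⟩ := ENat.ne_top_iff_exists.mp hxo
    obtain ⟨n, hn⟩ := ENat.ne_top_iff_exists.mp hyo
    rw [← hm, ← hn] at h ⊢
    have h' : ((3 * m : ℕ) : ℕ∞) = ((3 * n : ℕ) : ℕ∞) := by
      simpa [nsmul_eq_mul] using h
    have := ENat.coe_inj.mp h'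
    congr 1; omega
  -- the `X`-free parts have equal cubes and nonzero constant terms
  have h3 : (divXPowOrder x) ^ 3 = (divXPowOrder y) ^ 3 := by
    rw [← divXPowOrder_pow, ← divXPowOrder_pow, hxy]
  have hy0 : constantCoeff (divXPowOrder y) ≠ 0 := fun h0 => hy (constantCoeff_divXPowOrder_eq_zero_iff.mp h0)
  obtain ⟨ζ, hζ, heq⟩ := eq_C_mul_of_pow_three_eq h3 hy0
  refine ⟨ζ, hζ, ?_⟩
  rw [← X_pow_order_mul_divXPowOrder (f := x), ← X_pow_order_mul_divXPowOrder (f := y), hord, heq]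
  ring

end CubeRoots

end Summit.BirchSwinnertonDyer.BirchSwinnertonDyer.Theorems.ManinLocalTwoThree.KLineBI

end
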